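import Literature.MathematicalPhysics.QuantumLattice.FrozenEnvironmentWords
import HarnessLib

/-!
# The frozen-environment compression of a second-quantised Hamiltonian (spin-orbital form)

Topic `Literature/MathematicalPhysics/QuantumLattice`; the summed form of `FrozenEnvironmentWords.lean`.
For the isometry `V_K = frozenEmbed e K : 𝔉(ι) → 𝔉(ι')` along an order embedding `e : ι ↪o ι'` (the
environment orbitals of `K ⊆ ι' ∖ e ι` occupied, the other environment orbitals empty) and ARBITRARY
complex coefficient tables `T : ι' → ι' → ℂ`, `W : ι' → ι' → ι' → ι' → ℂ` (no symmetry assumed), the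
compressions of the one- and two-body parts of the general second-quantised Hamiltonian
`Σ_{ad} T_ad c†_a c_d + ½ Σ_{adbc} W_adbc c†_a c†_b c_c c_d` (Helgaker–Jørgensen–Olsen (2000) eq. (1.4.39),
`W_adbc = (ad|bc)`) are again of this form on the small space:

* `conjTranspose_frozenEmbed_mul_oneBody_mul_frozenEmbed`:
  `V_Kᴴ (Σ T_{i'j'} c†_{i'} c_{j'}) V_K = Σ_{ij} T_{ei,ej} c†_i c_j + (Σ_{k∈K} T_kk) · 1`;
* `conjTranspose_frozenEmbed_mul_twoBody_mul_frozenEmbed`: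
  `V_Kᴴ (Σ W_{i'j'k'l'} c†_{i'} c†_{k'} c_{l'} c_{j'}) V_K = Σ W_{ei,ej,ek,el} c†_i c†_k c_l c_j`
  `+ Σ_{ij} (Σ_{m∈K} (W_{ei,ej,m,m} + W_{m,m,ei,ej} − W_{ei,m,m,ej} − W_{m,ej,ei,m})) c†_i c_j`
  `+ (Σ_{m,m'∈K} (W_{mmm'm'} − W_{mm'm'm})) · 1`,
  i.e. the active block, the COULOMB-MINUS-EXCHANGE one-body field of the frozen orbitals (the
  two-electron part of the inactive Fock matrix, HJO (12.5.12) `Σ_i (2 g_mnii − g_miin)` in its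
  spin-orbital, general-table form) and the two-electron part of the inactive energy (12.5.16)
  (Koridon et al. (2021) App. A eqs. (A5)–(A6)).

Method: push `V_Kᴴ … V_K` through the sums, split every index into its image part and its
environment part (`sum_eq_sum_apply_add_sum_env`; 4 resp. 16 groups), evaluate each group with the
pattern lemmas of `FrozenEnvironmentWords.lean`, and contract the Kronecker deltas of the environment
indices (`sum_env_ite_coe_eq`, `sum_env_sum_env_ite`, `sum_group_…`). Everything is PROVED, 0 sorry, no
definition; the spinful molecular specialisation (spatial orbitals, `E_pq`, `e_pqrs`, doubly occupied
core) is `QuantumChemistry/FrozenCoreHamiltonian.lean`.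

References: T. Helgaker, P. Jørgensen, J. Olsen, *Molecular Electronic-Structure Theory* (Wiley 2000),
eq. (1.4.39), §12.5.1 eqs. (12.5.12), (12.5.16) [HelgakerJorgensenOlsen2000]; E. Koridon et al., Phys.
Rev. Research 3 (2021) 033127, App. A (A1)–(A6) [KoridonEtAl2021]; O. Bratteli, D. W. Robinson,
*Operator Algebras and Quantum Statistical Mechanics 2* (1997) §5.2.1 [BratteliRobinsonII1997].
-/

noncomputable section

namespace Literature.MathematicalPhysics.QuantumLattice

open Matrix Finset JWEmbed

variable {ι ι' : Type*} [LinearOrder ι] [LinearOrder ι'] [Fintype ι] [Fintype ι']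
variable (e : ι ↪o ι') {K : Finset ι'}

/-! ### Index bookkeeping: image part and environment part of a sum over the big orbital set -/

/-- A sum over the orbitals of the big space is the sum over the image orbitals plus the sum over the
environment orbitals. [cite: BratteliRobinsonII1997, §5.2.1 (Fock space 𝔉(𝔥₁ ⊕ 𝔥₂); occupation-number basis)] -/
theorem sum_eq_sum_apply_add_sum_env {M : Type*} [AddCommMonoid M] (f : ι' → M) :
    ∑ i', f i' = ∑ i, f (e i) + ∑ m : {m : ι' // m ∉ rangeF e}, f m := by
  rw [← Finset.sum_add_sum_compl (rangeF e) f,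
    Finset.sum_subtype (rangeF e)ᶜ (fun m => by rw [Finset.mem_compl]) f]
  congr 1
  rw [rangeF, Finset.sum_map]
  rfl

/-- Eliminating an environment index tied to another one by a Kronecker delta. [cite: HelgakerJorgensenOlsen2000, eq. (1.7.17)] -/
theorem sum_env_ite_coe_eq {M : Type*} [AddCommMonoid M] (a : {m : ι' // m ∉ rangeF e})
    (P : {m : ι' // m ∉ rangeF e} → Prop) [DecidablePred P] (G : {m : ι' // m ∉ rangeF e} → M) :
    ∑ x : {m : ι' // m ∉ rangeF e}, (if (a : ι') = x ∧ P x then G x else 0) = if P a then G a else 0 := by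
  rw [Finset.sum_eq_single a]
  · simp only [true_and]
  · intro x _ hx
    rw [if_neg]
    rintro ⟨h, -⟩
    exact hx (Subtype.ext h).symm
  · intro h
    exact absurd (Finset.mem_univ _) h

/-- An environment sum restricted to `K` is a sum over `K` (which lies in the environment).
[cite: HelgakerJorgensenOlsen2000, eq. (12.5.16) (sums over the inactive orbitals)] -/
theorem sum_env_ite_mem (hK : Disjoint K (rangeF e)) {M : Type*} [AddCommMonoid M] (g : ι' → M) :
    ∑ x : {m : ι' // m ∉ rangeF e}, (if (x : ι') ∈ K then g x else 0) = ∑ k ∈ K, g k := by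
  rw [← Finset.sum_subtype (rangeF e)ᶜ (fun m => by rw [Finset.mem_compl]) (fun m => if m ∈ K then g m else 0),
    ← Finset.sum_filter]
  congr 1
  ext m
  simp only [Finset.mem_filter, Finset.mem_compl]
  exact ⟨fun h => h.2, fun h => ⟨Finset.disjoint_left.1 hK h, h⟩⟩

/-- The environment pair sum `Σ_{m m'} [m = m' ∈ K] F m m' = Σ_{k ∈ K} F k k`.
[cite: HelgakerJorgensenOlsen2000, eq. (12.5.16) (sums over the inactive orbitals)] -/
theorem sum_env_sum_env_ite (hK : Disjoint K (rangeF e)) {M : Type*} [AddCommMonoid M] (F : ι' → ι' → M) :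
    ∑ m : {m : ι' // m ∉ rangeF e}, ∑ m' : {m : ι' // m ∉ rangeF e},
        (if (m : ι') = m' ∧ (m : ι') ∈ K then F m m' else 0) = ∑ k ∈ K, F k k := by
  have h1 : ∀ m : {m : ι' // m ∉ rangeF e},
      ∑ m' : {m : ι' // m ∉ rangeF e}, (if (m : ι') = m' ∧ (m : ι') ∈ K then F m m' else 0) =
        if (m : ι') ∈ K then F m m else 0 := fun m =>
    sum_env_ite_coe_eq e m (fun _ => (m : ι') ∈ K) (fun m' => F m m')
  rw [Finset.sum_congr rfl fun m _ => h1 m]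
  exact sum_env_ite_mem e hK (fun m => F m m)

/-- Eliminating an environment index tied to another one by a Kronecker delta (bound = fixed
orientation). [cite: HelgakerJorgensenOlsen2000, eq. (1.7.17)] -/
theorem sum_env_ite_coe_eq' {M : Type*} [AddCommMonoid M] (a : {m : ι' // m ∉ rangeF e})
    (P : {m : ι' // m ∉ rangeF e} → Prop) [DecidablePred P] (G : {m : ι' // m ∉ rangeF e} → M) :
    ∑ x : {m : ι' // m ∉ rangeF e}, (if (x : ι') = a ∧ P x then G x else 0) = if P a then G a else 0 := by
  rw [Finset.sum_eq_single a]
  · simp only [true_and]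
  · intro x _ hx
    rw [if_neg]
    rintro ⟨h, -⟩
    exact hx (Subtype.ext h)
  · intro h
    exact absurd (Finset.mem_univ _) h

/-- Pulling a constant condition out of an environment sum restricted to `K`.
[cite: HelgakerJorgensenOlsen2000, eq. (12.5.16) (sums over the inactive orbitals)] -/
theorem sum_env_ite_and {M : Type*} [AddCommMonoid M] (Q : Prop) [Decidable Q]
    (G : {m : ι' // m ∉ rangeF e} → M) :
    ∑ x : {m : ι' // m ∉ rangeF e}, (if Q ∧ (x : ι') ∈ K then G x else 0) =
      if Q then ∑ x : {m : ι' // m ∉ rangeF e}, (if (x : ι') ∈ K then G x else 0) else 0 := by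
  by_cases hQ : Q
  · simp only [hQ, true_and, if_true]
  · simp only [hQ, false_and, if_false, Finset.sum_const_zero]

/-- Pulling two constant conditions out of an environment sum restricted to `K`.
[cite: HelgakerJorgensenOlsen2000, eq. (12.5.16) (sums over the inactive orbitals)] -/
theorem sum_env_ite_and_and {M : Type*} [AddCommMonoid M] (Q R : Prop) [Decidable Q] [Decidable R]
    (G : {m : ι' // m ∉ rangeF e} → M) :
    ∑ x : {m : ι' // m ∉ rangeF e}, (if Q ∧ R ∧ (x : ι') ∈ K then G x else 0) =
      if Q ∧ R then ∑ x : {m : ι' // m ∉ rangeF e}, (if (x : ι') ∈ K then G x else 0) else 0 := by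
  by_cases hQ : Q
  · by_cases hR : R
    · simp only [hQ, hR, true_and, if_true]
    · simp only [hR, false_and, and_false, if_false, Finset.sum_const_zero]
  · simp only [hQ, false_and, if_false, Finset.sum_const_zero]

/-! ### The live environment groups of the two-body sum -/

/-- The `IEEI` group: `Σ_{ij} Σ_{m m'} W_{ei,ej,m,m'} [m = m' ∈ K] X_ij = Σ_{ij} (Σ_{k∈K} W_{ei,ej,k,k}) X_ij`.
[cite: HelgakerJorgensenOlsen2000, eq. (12.5.12) (the Coulomb term 2 g_mnii of the inactive Fock matrix)] -/
theorem sum_group_IEEI (hK : Disjoint K (rangeF e)) {M : Type*} [AddCommGroup M] [Module ℂ M]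
    (W : ι' → ι' → ι' → ι' → ℂ) (X : ι → ι → M) :
    ∑ i, ∑ j, ∑ m : {m : ι' // m ∉ rangeF e}, ∑ m' : {m : ι' // m ∉ rangeF e},
        W (e i) (e j) m m' • (if (m : ι') = m' ∧ (m : ι') ∈ K then X i j else 0) =
      ∑ i, ∑ j, (∑ k ∈ K, W (e i) (e j) k k) • X i j := by
  refine Finset.sum_congr rfl fun i _ => Finset.sum_congr rfl fun j _ => ?_
  simp only [smul_ite, smul_zero]
  rw [sum_env_sum_env_ite e hK (fun a b => W (e i) (e j) a b • X i j), Finset.sum_smul]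

/-- The `EIIE` group: `Σ_{m m'} Σ_{kl} W_{m,m',ek,el} [m = m' ∈ K] X_kl = Σ_{kl} (Σ_{k₀∈K} W_{k₀,k₀,ek,el}) X_kl`.
[cite: HelgakerJorgensenOlsen2000, eq. (12.5.12) (the Coulomb term 2 g_mnii of the inactive Fock matrix)] -/
theorem sum_group_EIIE (hK : Disjoint K (rangeF e)) {M : Type*} [AddCommGroup M] [Module ℂ M]
    (W : ι' → ι' → ι' → ι' → ℂ) (X : ι → ι → M) :
    ∑ m : {m : ι' // m ∉ rangeF e}, ∑ m' : {m : ι' // m ∉ rangeF e}, ∑ k, ∑ l,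
        W m m' (e k) (e l) • (if (m : ι') = m' ∧ (m : ι') ∈ K then X k l else 0) =
      ∑ k, ∑ l, (∑ k₀ ∈ K, W k₀ k₀ (e k) (e l)) • X k l := by
  have h1 : ∀ m m' : {m : ι' // m ∉ rangeF e},
      ∑ k, ∑ l, W m m' (e k) (e l) • (if (m : ι') = m' ∧ (m : ι') ∈ K then X k l else 0) =
        if (m : ι') = m' ∧ (m : ι') ∈ K then ∑ k, ∑ l, W m m' (e k) (e l) • X k l else 0 := by
    intro m m'
    split_ifs
    · rfl
    · simp only [smul_zero, Finset.sum_const_zero]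
  simp only [h1]
  rw [sum_env_sum_env_ite e hK (fun a b => ∑ k, ∑ l, W a b (e k) (e l) • X k l), Finset.sum_comm]
  refine Finset.sum_congr rfl fun k _ => ?_
  rw [Finset.sum_comm]
  refine Finset.sum_congr rfl fun l _ => ?_
  rw [Finset.sum_smul]

/-- The `IEIE` group (exchange): `Σ_i Σ_{m m'} Σ_l W_{ei,m,m',el} [m' = m ∈ K] Y_il = Σ_{il} (Σ_{k∈K} W_{ei,k,k,el}) Y_il`.
[cite: HelgakerJorgensenOlsen2000, eq. (12.5.12) (the exchange term -g_miin of the inactive Fock matrix)] -/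
theorem sum_group_IEIE (hK : Disjoint K (rangeF e)) {M : Type*} [AddCommGroup M] [Module ℂ M]
    (W : ι' → ι' → ι' → ι' → ℂ) (Y : ι → ι → M) :
    ∑ i, ∑ m : {m : ι' // m ∉ rangeF e}, ∑ m' : {m : ι' // m ∉ rangeF e}, ∑ l,
        W (e i) m m' (e l) • (if (m' : ι') = m ∧ (m' : ι') ∈ K then Y i l else 0) =
      ∑ i, ∑ l, (∑ k ∈ K, W (e i) k k (e l)) • Y i l := by
  refine Finset.sum_congr rfl fun i _ => ?_
  have h1 : ∀ m m' : {m : ι' // m ∉ rangeF e},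
      ∑ l, W (e i) m m' (e l) • (if (m' : ι') = m ∧ (m' : ι') ∈ K then Y i l else 0) =
        if (m' : ι') = m ∧ (m' : ι') ∈ K then ∑ l, W (e i) m m' (e l) • Y i l else 0 := by
    intro m m'
    split_ifs
    · rfl
    · simp only [smul_zero, Finset.sum_const_zero]
  simp only [h1]
  simp only [sum_env_ite_coe_eq' e _ (fun x => (x : ι') ∈ K)]
  rw [sum_env_ite_mem e hK (fun a => ∑ l, W (e i) a a (e l) • Y i l), Finset.sum_comm]
  refine Finset.sum_congr rfl fun l _ => ?_
  rw [Finset.sum_smul]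

/-- The `EIEI` group (exchange): `Σ_m Σ_{jk} Σ_{m'} W_{m,ej,ek,m'} [m = m' ∈ K] Y_kj = Σ_k Σ_j (Σ_{k₀∈K} W_{k₀,ej,ek,k₀}) Y_kj`.
[cite: HelgakerJorgensenOlsen2000, eq. (12.5.12) (the exchange term -g_miin of the inactive Fock matrix)] -/
theorem sum_group_EIEI (hK : Disjoint K (rangeF e)) {M : Type*} [AddCommGroup M] [Module ℂ M]
    (W : ι' → ι' → ι' → ι' → ℂ) (Y : ι → ι → M) :
    ∑ m : {m : ι' // m ∉ rangeF e}, ∑ j, ∑ k, ∑ m' : {m : ι' // m ∉ rangeF e},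
        W m (e j) (e k) m' • (if (m : ι') = m' ∧ (m : ι') ∈ K then Y k j else 0) =
      ∑ k, ∑ j, (∑ k₀ ∈ K, W k₀ (e j) (e k) k₀) • Y k j := by
  simp only [smul_ite, smul_zero]
  simp only [sum_env_ite_coe_eq e _ (fun _ => _ ∈ K)]
  have h1 : ∀ m : {m : ι' // m ∉ rangeF e},
      ∑ j, ∑ k, (if (m : ι') ∈ K then W m (e j) (e k) m • Y k j else 0) =
        if (m : ι') ∈ K then ∑ j, ∑ k, W m (e j) (e k) m • Y k j else 0 := by
    intro m
    split_ifs
    · rfl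
    · simp only [Finset.sum_const_zero]
  simp only [h1]
  have h2 : ∀ a : ι', ∑ j, ∑ k, W a (e j) (e k) a • Y k j = ∑ k, ∑ j, W a (e j) (e k) a • Y k j :=
    fun a => Finset.sum_comm
  simp only [h2]
  rw [sum_env_ite_mem e hK (fun a => ∑ k, ∑ j, W a (e j) (e k) a • Y k j), Finset.sum_comm]
  refine Finset.sum_congr rfl fun k _ => ?_
  rw [Finset.sum_comm]
  refine Finset.sum_congr rfl fun j _ => ?_
  rw [Finset.sum_smul]

/-- The `EEEE` group: the two-electron energy of the occupation vector `|K⟩`,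
`Σ W_{m₁m₂m₃m₄} ([m₃ = m₄][m₁ = m₂] - [m₁ = m₄][m₃ = m₂]) [m₁, m₃ ∈ K] = Σ_{k,k'∈K} (W_{kkk'k'} - W_{kk'k'k})`
(Coulomb minus exchange, HJO (12.5.16) / Koridon (A5)). [cite: HelgakerJorgensenOlsen2000, eq. (12.5.16)] -/
theorem sum_group_EEEE (hK : Disjoint K (rangeF e)) {M : Type*} [AddCommGroup M] [Module ℂ M]
    (W : ι' → ι' → ι' → ι' → ℂ) (x : M) :
    ∑ m₁ : {m : ι' // m ∉ rangeF e}, ∑ m₂ : {m : ι' // m ∉ rangeF e}, ∑ m₃ : {m : ι' // m ∉ rangeF e},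
      ∑ m₄ : {m : ι' // m ∉ rangeF e}, W m₁ m₂ m₃ m₄ •
        (((if (m₃ : ι') = m₄ ∧ (m₁ : ι') = m₂ ∧ (m₁ : ι') ∈ K ∧ (m₃ : ι') ∈ K then (1 : ℂ) else 0) -
          (if (m₁ : ι') = m₄ ∧ (m₃ : ι') = m₂ ∧ (m₁ : ι') ∈ K ∧ (m₃ : ι') ∈ K then (1 : ℂ) else 0)) • x) =
      (∑ k ∈ K, ∑ k' ∈ K, (W k k k' k' - W k k' k' k)) • x := by
  simp only [smul_smul, ← Finset.sum_smul]
  congr 1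
  simp only [mul_sub, Finset.sum_sub_distrib, mul_ite, mul_one, mul_zero]
  simp only [sum_env_ite_coe_eq e, sum_env_ite_coe_eq' e, sum_env_ite_and_and e, sum_env_ite_and e]
  simp only [← sum_env_ite_mem e hK]

/-! ### The one-body sum -/

/-- **Frozen-environment compression of a one-body operator**:
`V_Kᴴ (Σ_{i'j'} T_{i'j'} c†_{i'} c_{j'}) V_K = Σ_{ij} T_{e i, e j} c†_i c_j + (Σ_{k ∈ K} T_kk) · 1` — the
active block of `T` plus the trace of `T` over the frozen orbitals (HJO (12.5.16): `Σ_i h_ii` of the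
inactive energy; Koridon et al. (A5): `2 Σ_i h_ii`). [cite: HelgakerJorgensenOlsen2000, eq. (12.5.16)] -/
theorem conjTranspose_frozenEmbed_mul_oneBody_mul_frozenEmbed (hK : Disjoint K (rangeF e))
    (T : ι' → ι' → ℂ) :
    (frozenEmbed e K)ᴴ * (∑ i', ∑ j', T i' j' • (creation i' * annihilation j')) * frozenEmbed e K =
      ∑ i, ∑ j, T (e i) (e j) • (creation i * annihilation j) +
        (∑ k ∈ K, T k k) • (1 : Matrix (Finset ι) (Finset ι) ℂ) := by
  simp only [Matrix.mul_sum, Matrix.sum_mul, Matrix.mul_smul, Matrix.smul_mul]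
  simp only [sum_eq_sum_apply_add_sum_env e, Finset.sum_add_distrib]
  simp only [sandwichOne_II e hK, fun (m : {m : ι' // m ∉ rangeF e}) => sandwichOne_IE e hK m.2,
    fun (m : {m : ι' // m ∉ rangeF e}) => sandwichOne_EI e hK m.2,
    fun (m m' : {m : ι' // m ∉ rangeF e}) => sandwichOne_EE e hK m.2 m'.2,
    smul_zero, Finset.sum_const_zero, add_zero, zero_add, smul_ite]
  rw [sum_env_sum_env_ite e hK (fun m m' => T m m' • (1 : Matrix (Finset ι) (Finset ι) ℂ)), Finset.sum_smul]

/-! ### The two-body sum -/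

/-- **Frozen-environment compression of a two-body operator** (string `c†_a c†_b c_c c_d` weighted by
`W a d b c`, the index order of `Σ (ad|bc) c†_a c†_b c_c c_d`):
`V_Kᴴ (Σ W_{i'j'k'l'} c†_{i'} c†_{k'} c_{l'} c_{j'}) V_K = Σ W∘e c†_i c†_k c_l c_j`
`+ Σ_{ij} (Σ_{m ∈ K} (W_{ei,ej,m,m} + W_{m,m,ei,ej} - W_{ei,m,m,ej} - W_{m,ej,ei,m})) c†_i c_j`
`+ (Σ_{m,m' ∈ K} (W_{mmm'm'} - W_{mm'm'm})) · 1` — the active two-body part, the Coulomb-minus-exchange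
one-body field of the frozen orbitals (the two-electron part of the inactive Fock matrix, HJO (12.5.12),
in general-table form) and the two-electron part of the inactive energy (12.5.16).
[cite: HelgakerJorgensenOlsen2000, eq. (12.5.12)] -/
theorem conjTranspose_frozenEmbed_mul_twoBody_mul_frozenEmbed (hK : Disjoint K (rangeF e))
    (W : ι' → ι' → ι' → ι' → ℂ) :
    (frozenEmbed e K)ᴴ * (∑ i', ∑ j', ∑ k', ∑ l', W i' j' k' l' •
        (creation i' * creation k' * annihilation l' * annihilation j')) * frozenEmbed e K =
      ∑ i, ∑ j, ∑ k, ∑ l, W (e i) (e j) (e k) (e l) • (creation i * creation k * annihilation l * annihilation j) +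
      ∑ i, ∑ j, (∑ m ∈ K, (W (e i) (e j) m m + W m m (e i) (e j) - W (e i) m m (e j) - W m (e j) (e i) m)) •
        (creation i * annihilation j) +
      (∑ m ∈ K, ∑ m' ∈ K, (W m m m' m' - W m m' m' m)) • (1 : Matrix (Finset ι) (Finset ι) ℂ) := by
  simp only [Matrix.mul_sum, Matrix.sum_mul, Matrix.mul_smul, Matrix.smul_mul]
  simp only [sum_eq_sum_apply_add_sum_env e, Finset.sum_add_distrib]
  simp only [sandwichTwo_IIII e hK,
    fun (m : {m : ι' // m ∉ rangeF e}) => sandwichTwo_IIIE e hK m.2,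
    fun (m : {m : ι' // m ∉ rangeF e}) => sandwichTwo_IIEI e hK m.2,
    fun (m : {m : ι' // m ∉ rangeF e}) => sandwichTwo_IEII e hK m.2,
    fun (m : {m : ι' // m ∉ rangeF e}) => sandwichTwo_EIII e hK m.2,
    fun (m m' : {m : ι' // m ∉ rangeF e}) => sandwichTwo_IIEE e hK m.2 (m' : ι'),
    fun (m m' : {m : ι' // m ∉ rangeF e}) => sandwichTwo_EEII e hK m.2 (m' : ι'),
    fun (m₁ m₂ m₃ : {m : ι' // m ∉ rangeF e}) => sandwichTwo_EEIE e hK m₁.2 m₂.2 m₃.2,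
    fun (m₁ m₂ m₄ : {m : ι' // m ∉ rangeF e}) => sandwichTwo_EIEE e hK (m₁ : ι') m₂.2 m₄.2,
    fun (m₁ m₃ m₄ : {m : ι' // m ∉ rangeF e}) => sandwichTwo_EEEI e hK m₁.2 m₃.2 m₄.2,
    fun (m₃ m₂ m₄ : {m : ι' // m ∉ rangeF e}) => sandwichTwo_IEEE e hK (m₃ : ι') m₂.2 m₄.2,
    fun (m m' : {m : ι' // m ∉ rangeF e}) => sandwichTwo_EIIE e hK m.2 m'.2,
    fun (m m' : {m : ι' // m ∉ rangeF e}) => sandwichTwo_IEEI e hK m.2 m'.2,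
    fun (m m' : {m : ι' // m ∉ rangeF e}) => sandwichTwo_EIEI e hK m.2 m'.2,
    fun (m m' : {m : ι' // m ∉ rangeF e}) => sandwichTwo_IEIE e hK m.2 m'.2,
    fun (m₁ m₂ m₃ m₄ : {m : ι' // m ∉ rangeF e}) => sandwichTwo_EEEE e hK m₁.2 m₂.2 m₃.2 m₄.2,
    smul_zero, Finset.sum_const_zero, add_zero, zero_add]
  rw [sum_group_IEEI e hK W (fun i j => creation i * annihilation j),
    sum_group_IEIE e hK W (fun i l => -(creation i * annihilation l)),
    sum_group_EIEI e hK W (fun k j => -(creation k * annihilation j)),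
    sum_group_EIIE e hK W (fun k l => creation k * annihilation l),
    sum_group_EEEE e hK W (1 : Matrix (Finset ι) (Finset ι) ℂ)]
  simp only [smul_neg, Finset.sum_neg_distrib, Finset.sum_add_distrib, Finset.sum_sub_distrib, add_smul,
    sub_smul]
  abel

end Literature.MathematicalPhysics.QuantumLattice

end
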